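import Literature.Analysis.PDE.FrameOperator
import Literature.Analysis.PDE.TimeSobolevSup
import Literature.Analysis.Calculus.JointSmoothnessPartialsWithin
import Literature.Analysis.FluidPDE.ClassicalSolutionCalculus
import Literature.Analysis.FluidPDE.EnergyToolkit
import HarnessLib

/-!
# Joint smoothness up to the initial time of classical solutions of linear second-order systems
# (topic `Analysis/PDE`)

Analytic layer of the programme to prove short-time existence for quasilinear strictly parabolic
systems on a closed manifold (hypothesis `hQL` of
`Literature.Geometry.Riemannian.ricciFlow_shortTime_existence_of_quasilinear`). The linear
existence theorem of that programme produces, in every chart, the solution `w` as a limit which is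
smooth in space at each time, with all spatial word derivatives jointly continuous on the closed
slab `[0, T] × E'` and differentiable in time within `[0, T]` through the equation,

  `∂ₜ ∂_β w = ∂_β (L_t w + Θ̂)` on an open set `U`,  `L_t u y = frameOp (S t y) (𝔟 t y) (𝔠 t y) u y`,

with jointly smooth coefficient fields and source. This file proves that such a `w` is **jointly
`C^∞` on `[0, T] × U`** (`contDiffOn_slab_of_classical`), by the tower argument of Friedrichs
(as in the tree's `LinearSystemJointSmoothness.lean`, here second order, within the closed time
interval, on a general Euclidean model): the class of finite sums of cut-off fields
`χ(x) • c(t, x) ∂_β w(t, x)` and `χ(x) • g(t, x)` (`tsupport χ ⊆ U`) is stable under the spatial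
partial derivatives and — through the equation, pointwise where `χ ≠ 0` — under the time
derivative within `[0, T]`, and consists of jointly continuous fields; hence by induction every
field of the class is jointly `Cⁿ` within the slab for all `n` (criterion
`Literature.Analysis.Calculus.contDiffOn_succ_of_partial_within`). No Leibniz expansion of word
derivatives is needed: word derivatives of `L_t w + Θ̂` are obtained by iterating single
derivatives inside the (cut-off free) raw class.

Everything is proved; no named fact and no `sorry` is introduced.

## References

* K. O. Friedrichs, *Symmetric hyperbolic linear differential equations*, Comm. Pure Appl. Math.
  7 (1954) 345–392, §4 (differentiability of the solution). [Friedrichs1954]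
* J. Dieudonné, *Foundations of Modern Analysis*, Academic Press 1960, (8.12). [Dieudonne1960]
-/

noncomputable section

open Set Function Filter Topology Metric InnerProductSpace
open scoped ContDiff Topology RealInnerProductSpace

namespace Literature.Analysis.PDE

open Literature.Analysis.FunctionSpaces Literature.Analysis.FluidPDE Literature.Analysis.Calculus

variable {E' : Type*} [NormedAddCommGroup E'] [InnerProductSpace ℝ E'] [FiniteDimensional ℝ E']
variable {F' : Type*} [NormedAddCommGroup F'] [NormedSpace ℝ F']

namespace ParabolicTower

variable (T : ℝ) (w : ℝ → E' → F') (U : Set E')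

/-! ### The raw class and the cut-off class -/

/-- **The raw class**: finite sums of fields `(t, x) ↦ c(t, x) ∂_β w(t, x)` with slab-smooth
operator coefficients `c`, and of slab-smooth fields `g`. [cite: Friedrichs1954, §4] -/
inductive IsRaw : (ℝ → E' → F') → Prop
  | base {c : ℝ → E' → (F' →L[ℝ] F')} (hc : IsSmoothSpaceTimeOn (Icc 0 T) c) (β : List E') :
      IsRaw fun t x ↦ c t x (iterDirDeriv β (w t) x)
  | smooth {g : ℝ → E' → F'} (hg : IsSmoothSpaceTimeOn (Icc 0 T) g) : IsRaw g
  | zero : IsRaw fun _ _ ↦ 0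
  | add {G₁ G₂ : ℝ → E' → F'} : IsRaw G₁ → IsRaw G₂ → IsRaw fun t x ↦ G₁ t x + G₂ t x

/-- **The cut-off class**: finite sums of `χ(x) • G(t, x)` with `G` raw and `χ` smooth with
`tsupport χ ⊆ U`. [cite: Friedrichs1954, §4] -/
inductive IsCut : (ℝ → E' → F') → Prop
  | cut {χ : E' → ℝ} {G : ℝ → E' → F'} (hχ : ContDiff ℝ ∞ χ) (hχU : tsupport χ ⊆ U) (hG : IsRaw T w G) :
      IsCut fun t x ↦ χ x • G t x
  | zero : IsCut fun _ _ ↦ 0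
  | add {E₁ E₂ : ℝ → E' → F'} : IsCut E₁ → IsCut E₂ → IsCut fun t x ↦ E₁ t x + E₂ t x

variable {T w U}

section Basic

variable (hT : 0 < T) (hws : ∀ t ∈ Icc 0 T, ContDiff ℝ ∞ (w t))
  (hwc : ∀ β : List E', ContinuousOn (fun p : ℝ × E' ↦ iterDirDeriv β (w p.1) p.2) (Icc 0 T ×ˢ univ))

omit [FiniteDimensional ℝ E'] in
include hws in
/-- Raw fields are smooth in space at each time of the slab. [cite: Friedrichs1954, §4] -/
theorem IsRaw.contDiff_slice {G : ℝ → E' → F'} (hG : IsRaw T w G) {t : ℝ} (ht : t ∈ Icc 0 T) :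
    ContDiff ℝ ∞ (G t) := by
  induction hG with
  | base hc β => exact (hc.contDiff_slice ht).clm_apply (contDiff_iterDirDeriv (hws t ht) β)
  | smooth hg => exact hg.contDiff_slice ht
  | zero => exact contDiff_const
  | add _ _ ih₁ ih₂ => exact ih₁.add ih₂

omit [FiniteDimensional ℝ E'] in
include hws in
/-- Cut-off fields are smooth in space at each time of the slab. [cite: Friedrichs1954, §4] -/
theorem IsCut.contDiff_slice {G : ℝ → E' → F'} (hG : IsCut T w U G) {t : ℝ} (ht : t ∈ Icc 0 T) :
    ContDiff ℝ ∞ (G t) := by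
  induction hG with
  | cut hχ _ hG => exact hχ.smul (hG.contDiff_slice hws ht)
  | zero => exact contDiff_const
  | add _ _ ih₁ ih₂ => exact ih₁.add ih₂

omit [FiniteDimensional ℝ E'] in
include hwc in
/-- Raw fields are jointly continuous on the slab. [cite: Friedrichs1954, §4] -/
theorem IsRaw.continuousOn {G : ℝ → E' → F'} (hG : IsRaw T w G) :
    ContinuousOn (uncurry G) (Icc 0 T ×ˢ univ) := by
  induction hG with
  | base hc β => exact (ContDiffOn.continuousOn hc).clm_apply (hwc β)
  | smooth hg => exact ContDiffOn.continuousOn hg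
  | zero => exact continuousOn_const
  | add _ _ ih₁ ih₂ => exact ih₁.add ih₂

omit [FiniteDimensional ℝ E'] in
include hwc in
/-- Cut-off fields are jointly continuous on the slab. [cite: Friedrichs1954, §4] -/
theorem IsCut.continuousOn {G : ℝ → E' → F'} (hG : IsCut T w U G) :
    ContinuousOn (uncurry G) (Icc 0 T ×ˢ univ) := by
  induction hG with
  | @cut χ G hχ _ hG =>
    have h : ContinuousOn (fun p : ℝ × E' ↦ χ p.2) (Icc 0 T ×ˢ univ) := (hχ.continuous.comp continuous_snd).continuousOn
    exact h.smul (hG.continuousOn hwc)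
  | zero => exact continuousOn_const
  | add _ _ ih₁ ih₂ => exact ih₁.add ih₂

omit [FiniteDimensional ℝ E'] in
/-- The raw class is stable under application of a slab-smooth operator field.
[cite: Friedrichs1954, §4] -/
theorem IsRaw.clm_apply {G : ℝ → E' → F'} (hG : IsRaw T w G) {c' : ℝ → E' → (F' →L[ℝ] F')}
    (hc' : IsSmoothSpaceTimeOn (Icc 0 T) c') : IsRaw T w fun t x ↦ c' t x (G t x) := by
  induction hG with
  | @base c hc β =>
    have h : IsSmoothSpaceTimeOn (Icc 0 T) fun t x ↦ c' t x ∘L c t x := ContDiffOn.clm_comp hc' hc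
    exact IsRaw.base h β
  | smooth hg => exact IsRaw.smooth (ContDiffOn.clm_apply hc' hg)
  | zero => simpa using IsRaw.zero
  | add _ _ ih₁ ih₂ => simpa [map_add] using ih₁.add ih₂

omit [FiniteDimensional ℝ E'] in
include hT in
/-- **The raw class is stable under spatial derivatives.** [cite: Friedrichs1954, §4] -/
theorem IsRaw.fderiv_slice (hws : ∀ t ∈ Icc 0 T, ContDiff ℝ ∞ (w t)) {G : ℝ → E' → F'} (hG : IsRaw T w G) (v : E') :
    ∃ G' : ℝ → E' → F', IsRaw T w G' ∧ ∀ t ∈ Icc 0 T, ∀ x, fderiv ℝ (G t) x v = G' t x := by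
  induction hG with
  | @base c hc β =>
    refine ⟨fun t x ↦ (fderiv ℝ (c t) x v) (iterDirDeriv β (w t) x) + c t x (iterDirDeriv (v :: β) (w t) x),
      (IsRaw.base (IsSmoothSpaceTimeOn.fderiv_slice_apply hc (uniqueDiffOn_Icc hT) v) β).add (IsRaw.base hc (v :: β)), fun t ht x ↦ ?_⟩
    have hcd : DifferentiableAt ℝ (c t) x := ((hc.contDiff_slice ht).differentiable (by simp)) x
    have hgd : DifferentiableAt ℝ (iterDirDeriv β (w t)) x := ((contDiff_iterDirDeriv (hws t ht) β).differentiable (by simp)) x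
    rw [fderiv_clm_apply hcd hgd]
    simp only [_root_.add_apply, ContinuousLinearMap.coe_comp, Function.comp_apply, ContinuousLinearMap.flip_apply,
      iterDirDeriv_cons, add_comm]
  | @smooth g hg =>
    exact ⟨fun t x ↦ fderiv ℝ (g t) x v, IsRaw.smooth (IsSmoothSpaceTimeOn.fderiv_slice_apply hg (uniqueDiffOn_Icc hT) v), fun t _ x ↦ rfl⟩
  | zero => exact ⟨fun _ _ ↦ 0, IsRaw.zero, fun t _ x ↦ by simp⟩
  | @add G₁ G₂ h₁ h₂ ih₁ ih₂ =>
    obtain ⟨G₁', h₁', he₁⟩ := ih₁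
    obtain ⟨G₂', h₂', he₂⟩ := ih₂
    refine ⟨fun t x ↦ G₁' t x + G₂' t x, h₁'.add h₂', fun t ht x ↦ ?_⟩
    have hd₁ : DifferentiableAt ℝ (G₁ t) x := ((h₁.contDiff_slice hws ht).differentiable (by simp)) x
    have hd₂ : DifferentiableAt ℝ (G₂ t) x := ((h₂.contDiff_slice hws ht).differentiable (by simp)) x
    show fderiv ℝ (fun x ↦ G₁ t x + G₂ t x) x v = G₁' t x + G₂' t x
    rw [show (fun x ↦ G₁ t x + G₂ t x) = G₁ t + G₂ t from rfl, fderiv_add hd₁ hd₂, _root_.add_apply, he₁ t ht, he₂ t ht]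

omit [FiniteDimensional ℝ E'] in
include hT in
/-- **Word derivatives of raw fields are raw fields** (iterate the previous lemma).
[cite: Friedrichs1954, §4] -/
theorem IsRaw.iterDirDeriv_slice (hws : ∀ t ∈ Icc 0 T, ContDiff ℝ ∞ (w t)) {G : ℝ → E' → F'} (hG : IsRaw T w G) :
    ∀ β : List E', ∃ G' : ℝ → E' → F', IsRaw T w G' ∧ ∀ t ∈ Icc 0 T, ∀ x, iterDirDeriv β (G t) x = G' t x
  | [] => ⟨G, hG, fun t _ x ↦ rfl⟩
  | v :: β => by
    obtain ⟨G₁, h₁, he₁⟩ := IsRaw.iterDirDeriv_slice hws hG β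
    obtain ⟨G₂, h₂, he₂⟩ := h₁.fderiv_slice hT hws v
    refine ⟨G₂, h₂, fun t ht x ↦ ?_⟩
    have hfun : iterDirDeriv β (G t) = G₁ t := funext fun y ↦ he₁ t ht y
    simp only [iterDirDeriv_cons, hfun]
    exact he₂ t ht x

omit [FiniteDimensional ℝ E'] in
include hT in
/-- **The cut-off class is stable under spatial derivatives.** [cite: Friedrichs1954, §4] -/
theorem IsCut.fderiv_slice (hws : ∀ t ∈ Icc 0 T, ContDiff ℝ ∞ (w t)) {G : ℝ → E' → F'} (hG : IsCut T w U G) (v : E') :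
    ∃ G' : ℝ → E' → F', IsCut T w U G' ∧ ∀ t ∈ Icc 0 T, ∀ x, fderiv ℝ (G t) x v = G' t x := by
  induction hG with
  | @cut χ G hχ hχU hG =>
    obtain ⟨G', hG', he⟩ := hG.fderiv_slice hT hws v
    refine ⟨fun t x ↦ fderiv ℝ χ x v • G t x + χ x • G' t x,
      (IsCut.cut ((hχ.fderiv_right (m := ∞) (by norm_cast)).clm_apply contDiff_const)
        ((tsupport_fderiv_apply_subset ℝ v).trans hχU) hG).add (IsCut.cut hχ hχU hG'), fun t ht x ↦ ?_⟩
    have hχd : DifferentiableAt ℝ χ x := (hχ.differentiable (by simp)) x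
    have hGd : DifferentiableAt ℝ (G t) x := ((hG.contDiff_slice hws ht).differentiable (by simp)) x
    show fderiv ℝ (fun x ↦ χ x • G t x) x v = fderiv ℝ χ x v • G t x + χ x • G' t x
    rw [fderiv_fun_smul hχd hGd]
    simp only [_root_.add_apply, FunLike.coe_smul, Pi.smul_apply, ContinuousLinearMap.smulRight_apply, he t ht x]
    rw [add_comm]
  | zero => exact ⟨fun _ _ ↦ 0, IsCut.zero, fun t _ x ↦ by simp⟩
  | @add E₁ E₂ h₁ h₂ ih₁ ih₂ =>
    obtain ⟨E₁', h₁', he₁⟩ := ih₁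
    obtain ⟨E₂', h₂', he₂⟩ := ih₂
    refine ⟨fun t x ↦ E₁' t x + E₂' t x, h₁'.add h₂', fun t ht x ↦ ?_⟩
    have hd₁ : DifferentiableAt ℝ (E₁ t) x := ((h₁.contDiff_slice hws ht).differentiable (by simp)) x
    have hd₂ : DifferentiableAt ℝ (E₂ t) x := ((h₂.contDiff_slice hws ht).differentiable (by simp)) x
    show fderiv ℝ (fun x ↦ E₁ t x + E₂ t x) x v = E₁' t x + E₂' t x
    rw [show (fun x ↦ E₁ t x + E₂ t x) = E₁ t + E₂ t from rfl, fderiv_add hd₁ hd₂, _root_.add_apply, he₁ t ht, he₂ t ht]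

end Basic

/-! ### Stability under the time derivative, through the equation -/

section Time

variable {S : ℝ → E' → (E' →L[ℝ] E')} {𝔟 : ℝ → E' → ((E' →L[ℝ] F') →L[ℝ] F')} {𝔠 : ℝ → E' → (F' →L[ℝ] F')}
  {Θ : ℝ → E' → F'}
  (hT : 0 < T) (hws : ∀ t ∈ Icc 0 T, ContDiff ℝ ∞ (w t))
  (hS : IsSmoothSpaceTimeOn (Icc 0 T) S) (h𝔟 : IsSmoothSpaceTimeOn (Icc 0 T) 𝔟) (h𝔠 : IsSmoothSpaceTimeOn (Icc 0 T) 𝔠)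
  (hΘ : IsSmoothSpaceTimeOn (Icc 0 T) Θ)
  (hwd : ∀ β : List E', ∀ t ∈ Icc 0 T, ∀ x ∈ U, HasDerivWithinAt (fun s ↦ iterDirDeriv β (w s) x)
    (iterDirDeriv β (fun y ↦ frameOp (S t y) (𝔟 t y) (𝔠 t y) (w t) y + Θ t y) x) (Icc 0 T) t)

/-- Expansion of `𝔟 (Du)` in the frame: `𝔟 (Du(y)) = Σ_l (𝔟 ∘L Q_l) (∂_l u(y))`,
`Q_l w = ⟪b_l, ·⟫ ⊗ w`. [folklore] -/
theorem clm_fderiv_eq_sum (𝔟₀ : (E' →L[ℝ] F') →L[ℝ] F') {u : E' → F'} (y : E') :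
    𝔟₀ (fderiv ℝ u y) = ∑ l, (𝔟₀ ∘L ContinuousLinearMap.smulRightL ℝ E' F' (innerSL ℝ (stdOrthonormalBasis ℝ E' l)))
      (fderiv ℝ u y (stdOrthonormalBasis ℝ E' l)) := by
  have h : fderiv ℝ u y = ∑ l, ContinuousLinearMap.smulRightL ℝ E' F' (innerSL ℝ (stdOrthonormalBasis ℝ E' l))
      (fderiv ℝ u y (stdOrthonormalBasis ℝ E' l)) := by
    ext x
    simp only [FunLike.coe_sum, Finset.sum_apply, ContinuousLinearMap.smulRightL_apply_apply, ContinuousLinearMap.smulRight_apply,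
      innerSL_apply_apply]
    conv_lhs => rw [← (stdOrthonormalBasis ℝ E').sum_repr' x]
    rw [map_sum]
    exact Finset.sum_congr rfl fun l _ ↦ by rw [map_smul]
  conv_lhs => rw [h]
  rw [map_sum]
  rfl

omit [FiniteDimensional ℝ E'] in
/-- The raw class is closed under finite sums. [folklore] -/
theorem IsRaw.finset_sum {κ : Type*} (s : Finset κ) {G : κ → ℝ → E' → F'} (hG : ∀ k ∈ s, IsRaw T w (G k)) :
    IsRaw T w fun t x ↦ ∑ k ∈ s, G k t x := by
  classical
  induction s using Finset.induction_on with
  | empty => simpa using IsRaw.zero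
  | insert a s ha ih =>
    have h1 : IsRaw T w (G a) := hG a (Finset.mem_insert_self a s)
    have h2 := ih fun k hk ↦ hG k (Finset.mem_insert_of_mem hk)
    simpa [Finset.sum_insert ha] using h1.add h2

include hS h𝔟 h𝔠 hΘ in
/-- **The right-hand side `L_t w + Θ` is a raw field.** [cite: Friedrichs1954, §4] -/
theorem isRaw_rhs : IsRaw T w fun t y ↦ frameOp (S t y) (𝔟 t y) (𝔠 t y) (w t) y + Θ t y := by
  set e := stdOrthonormalBasis ℝ E' with he
  -- the principal part
  have hterm : ∀ k l, IsRaw T w fun t y ↦ (⟪e k, S t y (e l)⟫ • ContinuousLinearMap.id ℝ F') (iterDirDeriv [e k, e l] (w t) y) := by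
    intro k l
    refine IsRaw.base ?_ _
    unfold IsSmoothSpaceTimeOn at hS ⊢
    have hc : ContDiffOn ℝ ∞ (fun q : ℝ × E' ↦ ⟪e k, (S q.1 q.2) (e l)⟫) (Icc 0 T ×ˢ univ) :=
      contDiffOn_const.inner ℝ (hS.clm_apply contDiffOn_const)
    exact hc.smul contDiffOn_const
  have hP : IsRaw T w fun t y ↦ ∑ k, ∑ l, (⟪e k, S t y (e l)⟫ • ContinuousLinearMap.id ℝ F') (iterDirDeriv [e k, e l] (w t) y) :=
    IsRaw.finset_sum _ fun k _ ↦ IsRaw.finset_sum _ fun l _ ↦ hterm k l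
  -- the first-order part
  have hB : IsRaw T w fun t y ↦ ∑ l, (𝔟 t y ∘L ContinuousLinearMap.smulRightL ℝ E' F' (innerSL ℝ (e l)))
      (iterDirDeriv [e l] (w t) y) :=
    IsRaw.finset_sum _ fun l _ ↦ IsRaw.base (c := fun t y ↦ 𝔟 t y ∘L ContinuousLinearMap.smulRightL ℝ E' F' (innerSL ℝ (e l)))
      (ContDiffOn.clm_comp h𝔟 contDiffOn_const) _
  -- the zeroth-order part and the source
  have hC : IsRaw T w fun t y ↦ 𝔠 t y (iterDirDeriv [] (w t) y) := IsRaw.base h𝔠 []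
  have hΘ' : IsRaw T w Θ := IsRaw.smooth hΘ
  have heq : (fun t y ↦ frameOp (S t y) (𝔟 t y) (𝔠 t y) (w t) y + Θ t y) = fun t y ↦
      (∑ k, ∑ l, (⟪e k, S t y (e l)⟫ • ContinuousLinearMap.id ℝ F') (iterDirDeriv [e k, e l] (w t) y)) +
      (∑ l, (𝔟 t y ∘L ContinuousLinearMap.smulRightL ℝ E' F' (innerSL ℝ (e l))) (iterDirDeriv [e l] (w t) y)) +
      𝔠 t y (iterDirDeriv [] (w t) y) + Θ t y := by
    funext t y
    rw [frameOp_apply, principalPart_apply, clm_fderiv_eq_sum]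
    simp only [FunLike.coe_smul, Pi.smul_apply, ContinuousLinearMap.id_apply, iterDirDeriv_cons, iterDirDeriv_nil, he]
  rw [heq]
  exact ((hP.add hB).add hC).add hΘ'

include hT hws hS h𝔟 h𝔠 hΘ hwd in
/-- **The cut-off class is stable under the time derivative within `[0, T]`**: for `G` in the
class there is `G'` in the class with `d/dt G(t, x) = G'(t, x)` within `[0, T]` (through the
equation where the cut-off does not vanish). [cite: Friedrichs1954, §4] -/
theorem IsCut.hasDerivWithinAt {G : ℝ → E' → F'} (hG : IsCut T w U G) :
    ∃ G' : ℝ → E' → F', IsCut T w U G' ∧ ∀ t ∈ Icc 0 T, ∀ x, HasDerivWithinAt (fun s ↦ G s x) (G' t x) (Icc 0 T) t := by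
  have hrhs := isRaw_rhs (T := T) (w := w) hS h𝔟 h𝔠 hΘ
  induction hG with
  | @cut χ G hχ hχU hG =>
    -- inner induction on the raw structure of `G`
    induction hG with
    | @base c hc β =>
      obtain ⟨Gβ, hGβ, heβ⟩ := hrhs.iterDirDeriv_slice hT hws β
      refine ⟨fun t x ↦ χ x • ((timeDerivWithin (Icc 0 T) c t x) (iterDirDeriv β (w t) x) + c t x (Gβ t x)),
        IsCut.cut hχ hχU ((IsRaw.base (hc.timeDerivWithin (uniqueDiffOn_Icc hT)) β).add (hGβ.clm_apply hc)),
        fun t ht x ↦ ?_⟩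
      by_cases hxU : x ∈ U
      · have h1 := hc.hasDerivWithinAt_timeDerivWithin (uniqueDiffOn_Icc hT) ht x
        have h2 := hwd β t ht x hxU
        rw [heβ t ht x] at h2
        exact (h1.clm_apply h2).const_smul (χ x)
      · have hx0 : χ x = 0 := image_eq_zero_of_notMem_tsupport fun h ↦ hxU (hχU h)
        simp only [hx0, zero_smul]
        exact hasDerivWithinAt_const _ _ _
    | @smooth g hg =>
      refine ⟨fun t x ↦ χ x • timeDerivWithin (Icc 0 T) g t x,
        IsCut.cut hχ hχU (IsRaw.smooth (hg.timeDerivWithin (uniqueDiffOn_Icc hT))), fun t ht x ↦ ?_⟩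
      exact (hg.hasDerivWithinAt_timeDerivWithin (uniqueDiffOn_Icc hT) ht x).const_smul (χ x)
    | zero => exact ⟨fun _ _ ↦ 0, IsCut.zero, fun t _ x ↦ by simpa using hasDerivWithinAt_const t (Icc 0 T) (0 : F')⟩
    | @add G₁ G₂ _ _ ih₁ ih₂ =>
      obtain ⟨E₁', h₁', he₁⟩ := ih₁
      obtain ⟨E₂', h₂', he₂⟩ := ih₂
      refine ⟨fun t x ↦ E₁' t x + E₂' t x, h₁'.add h₂', fun t ht x ↦ ?_⟩
      have h := (he₁ t ht x).add (he₂ t ht x)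
      simp only [smul_add]
      exact h
  | zero => exact ⟨fun _ _ ↦ 0, IsCut.zero, fun t _ x ↦ hasDerivWithinAt_const t _ 0⟩
  | @add E₁ E₂ _ _ ih₁ ih₂ =>
    obtain ⟨E₁', h₁', he₁⟩ := ih₁
    obtain ⟨E₂', h₂', he₂⟩ := ih₂
    exact ⟨fun t x ↦ E₁' t x + E₂' t x, h₁'.add h₂', fun t ht x ↦ (he₁ t ht x).add (he₂ t ht x)⟩

end Time

/-! ### Joint smoothness -/

section Joint

variable {S : ℝ → E' → (E' →L[ℝ] E')} {𝔟 : ℝ → E' → ((E' →L[ℝ] F') →L[ℝ] F')} {𝔠 : ℝ → E' → (F' →L[ℝ] F')}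
  {Θ : ℝ → E' → F'}
  (hT : 0 < T) (hws : ∀ t ∈ Icc 0 T, ContDiff ℝ ∞ (w t))
  (hwc : ∀ β : List E', ContinuousOn (fun p : ℝ × E' ↦ iterDirDeriv β (w p.1) p.2) (Icc 0 T ×ˢ univ))
  (hS : IsSmoothSpaceTimeOn (Icc 0 T) S) (h𝔟 : IsSmoothSpaceTimeOn (Icc 0 T) 𝔟) (h𝔠 : IsSmoothSpaceTimeOn (Icc 0 T) 𝔠)
  (hΘ : IsSmoothSpaceTimeOn (Icc 0 T) Θ)
  (hwd : ∀ β : List E', ∀ t ∈ Icc 0 T, ∀ x ∈ U, HasDerivWithinAt (fun s ↦ iterDirDeriv β (w s) x)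
    (iterDirDeriv β (fun y ↦ frameOp (S t y) (𝔟 t y) (𝔠 t y) (w t) y + Θ t y) x) (Icc 0 T) t)

/-- The derivative of a slice through the frame: `Df(x) = Σ_i ⟪b_i, ·⟫ ⊗ ∂_{b_i} f(x)`. [folklore] -/
theorem fderiv_eq_sum_smulRight {f : E' → F'} (x : E') :
    fderiv ℝ f x = ∑ i, (innerSL ℝ (stdOrthonormalBasis ℝ E' i)).smulRight (fderiv ℝ f x (stdOrthonormalBasis ℝ E' i)) := by
  ext v
  simp only [FunLike.coe_sum, Finset.sum_apply, ContinuousLinearMap.smulRight_apply, innerSL_apply_apply]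
  conv_lhs => rw [← (stdOrthonormalBasis ℝ E').sum_repr' v]
  rw [map_sum]
  exact Finset.sum_congr rfl fun i _ ↦ by rw [map_smul]

include hT hws hwc hS h𝔟 h𝔠 hΘ hwd in
/-- **Every field of the cut-off class is jointly `Cⁿ` within the slab**, by induction on `n`.
[cite: Friedrichs1954, §4] -/
theorem IsCut.contDiffOn_nat (n : ℕ) {G : ℝ → E' → F'} (hG : IsCut T w U G) :
    ContDiffOn ℝ n (uncurry G) (Icc 0 T ×ˢ univ) := by
  induction n generalizing G with
  | zero => exact_mod_cast contDiffOn_zero.2 (hG.continuousOn hwc)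
  | succ n ih =>
    obtain ⟨Gt, hGt, hdt⟩ := hG.hasDerivWithinAt hT hws hS h𝔟 h𝔠 hΘ hwd
    choose Gx hGx hdx using fun i ↦ hG.fderiv_slice hT hws (stdOrthonormalBasis ℝ E' i)
    set f₁ : ℝ × E' → ℝ →L[ℝ] F' := fun p ↦ (1 : ℝ →L[ℝ] ℝ).smulRight (Gt p.1 p.2) with hf₁
    set f₂ : ℝ × E' → E' →L[ℝ] F' := fun p ↦ ∑ i, (innerSL ℝ (stdOrthonormalBasis ℝ E' i)).smulRight (Gx i p.1 p.2) with hf₂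
    have h₁ : ∀ p ∈ Icc 0 T ×ˢ (univ : Set E'), HasFDerivWithinAt (fun a ↦ uncurry G (a, p.2)) (f₁ p) (Icc 0 T) p.1 :=
      fun p hp ↦ (hdt p.1 (mem_prod.1 hp).1 p.2).hasFDerivWithinAt
    have h₂ : ∀ p ∈ Icc 0 T ×ˢ (univ : Set E'), HasFDerivAt (fun b ↦ uncurry G (p.1, b)) (f₂ p) p.2 := by
      intro p hp
      have ht : p.1 ∈ Icc 0 T := (mem_prod.1 hp).1
      have hd : DifferentiableAt ℝ (G p.1) p.2 := ((hG.contDiff_slice hws ht).differentiable (by simp)) p.2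
      have heq : fderiv ℝ (G p.1) p.2 = f₂ p := by
        rw [fderiv_eq_sum_smulRight, hf₂]
        exact Finset.sum_congr rfl fun i _ ↦ by rw [hdx i p.1 ht p.2]
      exact heq ▸ hd.hasFDerivAt
    have hc₁ : ContDiffOn ℝ n f₁ (Icc 0 T ×ˢ univ) := ContDiffOn.smulRight contDiffOn_const (ih hGt)
    have hc₂ : ContDiffOn ℝ n f₂ (Icc 0 T ×ˢ univ) :=
      ContDiffOn.sum fun i _ ↦ ContDiffOn.smulRight contDiffOn_const (ih (hGx i))
    exact contDiffOn_succ_of_partial_within (f := uncurry G) (convex_Icc 0 T) (uniqueDiffOn_Icc hT) h₁ h₂ hc₁ hc₂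

include hT hws hwc hS h𝔟 h𝔠 hΘ hwd in
/-- **Joint smoothness of cut-off classical solutions up to the initial time**: for every smooth
`χ` with `tsupport χ ⊆ U`, `(t, x) ↦ χ(x) • w(t, x)` is `C^∞` on `[0, T] × E'` (within).
[cite: Friedrichs1954, §4] -/
theorem contDiffOn_slab_cut_smul {χ : E' → ℝ} (hχ : ContDiff ℝ ∞ χ) (hχU : tsupport χ ⊆ U) :
    ContDiffOn ℝ ∞ (uncurry fun t x ↦ χ x • w t x) (Icc 0 T ×ˢ univ) := by
  have hbase : IsCut T w U fun t x ↦ χ x • (ContinuousLinearMap.id ℝ F') (iterDirDeriv [] (w t) x) :=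
    IsCut.cut hχ hχU (IsRaw.base (c := fun _ _ ↦ ContinuousLinearMap.id ℝ F') contDiffOn_const [])
  have heq : (uncurry fun t x ↦ χ x • w t x) = uncurry fun t x ↦ χ x • (ContinuousLinearMap.id ℝ F') (iterDirDeriv [] (w t) x) := by
    funext p; simp [iterDirDeriv_nil]
  rw [heq, contDiffOn_infty]
  intro n
  exact hbase.contDiffOn_nat hT hws hwc hS h𝔟 h𝔠 hΘ hwd n

include hT hws hwc hS h𝔟 h𝔠 hΘ hwd in
/-- **Joint smoothness of classical solutions up to the initial time** (`U` open): `w` is `C^∞` on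
`[0, T] × U` within. [cite: Friedrichs1954, §4] -/
theorem contDiffOn_slab_of_classical (hU : IsOpen U) : ContDiffOn ℝ ∞ (uncurry w) (Icc 0 T ×ˢ U) := by
  rintro ⟨t, x⟩ hp
  have ht : t ∈ Icc 0 T := (mem_prod.1 hp).1
  have hx : x ∈ U := (mem_prod.1 hp).2
  -- a bump equal to one near `x`, supported in `U`
  obtain ⟨ε, hε, hball⟩ := Metric.isOpen_iff.1 hU x hx
  let b : ContDiffBump x := ⟨ε / 4, ε / 2, by linarith, by linarith⟩
  have hbU : tsupport (b : E' → ℝ) ⊆ U := by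
    rw [b.tsupport_eq]; exact (closedBall_subset_ball (by show ε / 2 < ε; linarith)).trans hball
  have hsm := contDiffOn_slab_cut_smul hT hws hwc hS h𝔟 h𝔠 hΘ hwd b.contDiff hbU
  -- near `(t, x)` within the slab the cut-off product is `w`
  have h1 : ContDiffWithinAt ℝ ∞ (uncurry fun t x ↦ (b : E' → ℝ) x • w t x) (Icc 0 T ×ˢ univ) (t, x) :=
    hsm (t, x) (mk_mem_prod ht (mem_univ _))
  have hev : (uncurry w) =ᶠ[𝓝[Icc 0 T ×ˢ univ] (t, x)] uncurry fun t x ↦ (b : E' → ℝ) x • w t x := by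
    have hO : IsOpen (univ ×ˢ ball x (ε / 4) : Set (ℝ × E')) := isOpen_univ.prod isOpen_ball
    have hmem : (t, x) ∈ (univ ×ˢ ball x (ε / 4) : Set (ℝ × E')) := mk_mem_prod (mem_univ _) (mem_ball_self (by linarith))
    filter_upwards [mem_nhdsWithin_of_mem_nhds (hO.mem_nhds hmem)] with q hq
    have hq2 : q.2 ∈ closedBall x (ε / 4) := ball_subset_closedBall (mem_prod.1 hq).2
    simp only [uncurry]
    rw [b.one_of_mem_closedBall hq2, one_smul]
  have h2 : ContDiffWithinAt ℝ ∞ (uncurry w) (Icc 0 T ×ˢ univ) (t, x) :=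
    h1.congr_of_eventuallyEq hev (by
      show w t x = (b : E' → ℝ) x • w t x
      rw [b.one_of_mem_closedBall (mem_closedBall_self (by positivity)), one_smul])
  exact h2.mono (prod_mono le_rfl (subset_univ _))

end Joint

end ParabolicTower

end Literature.Analysis.PDE
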